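import Summits.QuantumFields.BalabanUV.Beta.GAN24.TwoLegChainKing

/-!
# `BalabanUV.Beta.GAN24.ThreeLegChainKing` — binder row G-an2-4 ∕ (CONV-C), route R7, road P2: the ABSTRACT THREE-LEG CHAIN against King's parent —
# `K(s;s′;s″) = Σ_x η^{d+1} Σ_{ijl} m(x,i,j,l)·P(x,i;s)·Q(x,j;s′)·W(x,l;s″)` (three fine legs at ONE point joined by a local CUBIC vertex): BOTH
# (CONV-C)-type clauses — decay `e^{−(δ∕3)(|y−y′|+|y′−y″|)}` and the Leibniz one-step bound — from DISPLAYED leg letters (block decay, parent law)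
# and vertex letters (bound, transport); the three-leg analogue of `TwoLegChainKing` (an1's cubic rows; p3 g25's `SoftColumnVertexRate` is the
# operator-currency precedent for VALUE legs without decay)

NOT IN PRINT; OUR PROOF ATTEMPT (unit `b2b-balaban-gan24-p2`, gen 31 = prover-b2b-balaban-gan24-p2-g31-0, road-P2 chair of row G-an2-4;
CRUX TEAM (2) under the ruling «YM REDIRECT TOWARDS THE SUMMIT», 2026-08-21).  HONEST FRAMING (cell contract, verbatim): «discharging
`BetaPertH` makes Bałaban's UV stability UNCONDITIONAL — a real constructive-QFT result; it is NOT the continuum limit and NOT the Clay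
problem.»  HONEST DEPENDENCY (verbatim): «continuum YM on T⁴ ⇐ BetaPertH ∧ nine spine estimates (0/9 proved); BetaPertH ⇐ (D1) ∧ (D4) ∧
CAP+tail; G-an2-4 gates asym, D1 and NE2/3/4.»  ABSOLUTE RULE: nothing printed is a hypothesis; no `def … : Prop`, no `sorry`; [folklore]
finite sums BY NAME (`GradientVertexChainKing.sum_blockConst`, `TwoLegChainKing.sum_child_par_complex`, b05's `sum_exp_torusSupNorm_sub_rep_le`,
`T4EtaRateOperatorTorus.torusSupNorm_add_le`).  Which of an1's rows a given `(P, Q, W, m)` realises is NOT claimed (S1 = an2∕p1's).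

## Content (0 sorry; torus model, dimension `d+1 ≥ 1`, every period vector)
 * §1 `chain3 n M P Q W m s s′ s″ := Σ_x (n^{d+1})⁻¹ Σ_{i:ι} Σ_{j:κ} Σ_{l:ν} m x i j l · P x i s · Q x j s′ · W x l s″`.
 * §2 **`sum_exp_three_centre_le`**: `Σ_t e^{−δ|t−y|}e^{−δ|t−y′|}e^{−δ|t−y″|} ≤ latticeConst(d+1,δ∕3)·e^{−(δ∕3)(|y−y′|_T + |y′−y″|_T)}`.
 * §3 **`norm_chain3_le`** (DECAY): `|P| ≤ CP·e^{…}`, `|Q| ≤ CQ·e^{…}`, `|W| ≤ CW·e^{…}`, `|m| ≤ B` ⇒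
   `‖K(s;s′;s″)‖ ≤ |ι||κ||ν|·B·CP·CQ·CW·latticeConst(δ∕3)·e^{−(δ∕3)(|y−y′|+|y′−y″|)}`.
 * §4 **`norm_chain3_succ_sub_le`** (ONE STEP, general `N, R`): with parent laws `ρP, ρQ, ρW` and vertex transport `εm`,
   `‖K′ − K‖ ≤ |ι||κ||ν|·(ρP·B·CQ·CW + CP·εm·CQ·CW + CP·B·ρQ·CW + CP·B·CQ·ρW)·latticeConst(δ∕3)·e^{−(δ∕3)(|y−y′|+|y′−y″|)}`.
HONEST.  [folklore]; no analysis (all in the displayed letters); U = 1 vocabulary; NOT (CONV-C) as a whole, NEVER «G-an2-4 closed», NOT NE2, NOT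
D1, NOT BetaPertH, NOT continuum, NOT Clay.  Text locations only: [King1986] §4 p. 672 (Leibniz mechanism), p. 664 (parent map).
-/

noncomputable section

open scoped BigOperators
open Finset

namespace Summit.QuantumFields.BalabanUV.Beta.GAN24.ThreeLegChainKing

open Literature.MathematicalPhysics.QuantumFieldTheory.Balaban1983to89
open Literature.MathematicalPhysics.QuantumFieldTheory.Balaban1983to89.B5Prop11Plancherel (Tor fine)
open Literature.MathematicalPhysics.QuantumFieldTheory.Balaban1983to89.B4TorusKernel.MultiPeriod (torusSupNorm)
open Literature.MathematicalPhysics.QuantumFieldTheory.Balaban1983to89.B4Sect5Proof (latticeConst latticeConst_nonneg)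
open Literature.MathematicalPhysics.QuantumFieldTheory.Balaban1983to89.B5Blocks16 (blockOf)
open Literature.MathematicalPhysics.QuantumFieldTheory.Balaban1983to89.B6LowerBound2153Torus (toT rep toT_rep)
open Literature.MathematicalPhysics.QuantumFieldTheory.Balaban1983to89.B5Hk163TorusHolderRate (sum_exp_torusSupNorm_sub_rep_le)
open Literature.MathematicalPhysics.QuantumFieldTheory.Balaban1983to89.T4EtaRateOperatorTorus (torusSupNorm_add_le torusSupNorm_neg)
open Summit.QuantumFields.BalabanUV.T4Continuum.BalabanAveragedTowerModes (par)
open Summit.QuantumFields.BalabanUV.Beta.GAN24.GradientVertexChainKing (sum_blockConst)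
open Summit.QuantumFields.BalabanUV.Beta.GAN24.TwoLegChainKing (Src sum_child_par_complex)

variable {d : ℕ} {ι κ ν : Type*} [Fintype ι] [Fintype κ] [Fintype ν]

/-! ## §1 The three-leg chain -/

section Defs

variable (n : ℕ) [NeZero n] (M : Fin (d + 1) → ℕ) [hM : ∀ μ, NeZero (M μ)]

/-- **THE THREE-LEG CHAIN** `K(s;s′;s″) = Σ_x (n^{d+1})⁻¹ Σ_{ijl} m x i j l · P x i s · Q x j s′ · W x l s″`. [folklore] -/
def chain3 (P : Tor (fine n M) → ι → Src M → ℂ) (Q : Tor (fine n M) → κ → Src M → ℂ) (W : Tor (fine n M) → ν → Src M → ℂ)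
    (m : Tor (fine n M) → ι → κ → ν → ℂ) (s s' s'' : Src M) : ℂ :=
  ∑ x : Tor (fine n M), ((((n : ℝ) ^ (d + 1))⁻¹ : ℝ) : ℂ) *
    ∑ i : ι, ∑ j : κ, ∑ l : ν, m x i j l * P x i s * Q x j s' * W x l s''

end Defs

/-! ## §2 The three-centre decay sum -/

section Sums

variable (M : Fin (d + 1) → ℕ) [hM : ∀ μ, NeZero (M μ)]

/-- `|a − b|_T ≤ |t − a|_T + |t − b|_T` on lattice representatives. [folklore] -/
theorem torusSupNorm_sub_le_two (t a b : Fin (d + 1) → ℤ) :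
    torusSupNorm M (a - b) ≤ torusSupNorm M (t - a) + torusSupNorm M (t - b) := by
  have h := torusSupNorm_add_le M (-(t - a)) (t - b)
  rw [torusSupNorm_neg] at h
  have e : -(t - a) + (t - b) = a - b := by ring
  rwa [e] at h

/-- **THE THREE-CENTRE DECAY SUM** (`δ > 0`): `Σ_t e^{−δ|t−y|}·e^{−δ|t−y′|}·e^{−δ|t−y″|} ≤ latticeConst(d+1,δ∕3)·e^{−(δ∕3)(|y−y′|_T + |y′−y″|_T)}` —
a third of each exponent pays the two source distances, a third is summed. [folklore] -/
theorem sum_exp_three_centre_le {δ : ℝ} (hδ : 0 < δ) (y y' y'' : Fin (d + 1) → ℤ) :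
    ∑ t : Tor M, Real.exp (-(δ * torusSupNorm M (rep M t - y))) * Real.exp (-(δ * torusSupNorm M (rep M t - y')))
        * Real.exp (-(δ * torusSupNorm M (rep M t - y'')))
      ≤ latticeConst (d + 1) (δ / 3) * Real.exp (-(δ / 3 * (torusSupNorm M (y - y') + torusSupNorm M (y' - y'')))) := by
  have h1M := B6Cov2156Torus.one_le_M M
  have hpt : ∀ t : Tor M,
      Real.exp (-(δ * torusSupNorm M (rep M t - y))) * Real.exp (-(δ * torusSupNorm M (rep M t - y'))) * Real.exp (-(δ * torusSupNorm M (rep M t - y'')))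
        ≤ Real.exp (-(δ / 3 * (torusSupNorm M (y - y') + torusSupNorm M (y' - y'')))) * Real.exp (-(δ / 3 * torusSupNorm M (y - rep M t))) := by
    intro t
    rw [← Real.exp_add, ← Real.exp_add, ← Real.exp_add]
    apply Real.exp_le_exp.mpr
    have ha := torusSupNorm_sub_le_two M (rep M t) y y'
    have hb := torusSupNorm_sub_le_two M (rep M t) y' y''
    have h0 : 0 ≤ torusSupNorm M (rep M t - y) := B4TorusKernel.MultiPeriod.torusSupNorm_nonneg h1M _
    have h0' : 0 ≤ torusSupNorm M (rep M t - y') := B4TorusKernel.MultiPeriod.torusSupNorm_nonneg h1M _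
    have h0'' : 0 ≤ torusSupNorm M (rep M t - y'') := B4TorusKernel.MultiPeriod.torusSupNorm_nonneg h1M _
    have hs : torusSupNorm M (y - rep M t) = torusSupNorm M (rep M t - y) := by rw [← torusSupNorm_neg M (y - rep M t), neg_sub]
    rw [hs]
    nlinarith
  calc _ ≤ ∑ t : Tor M, Real.exp (-(δ / 3 * (torusSupNorm M (y - y') + torusSupNorm M (y' - y'')))) * Real.exp (-(δ / 3 * torusSupNorm M (y - rep M t))) :=
        Finset.sum_le_sum fun t _ => hpt t
    _ = Real.exp (-(δ / 3 * (torusSupNorm M (y - y') + torusSupNorm M (y' - y'')))) * ∑ t : Tor M, Real.exp (-(δ / 3 * torusSupNorm M (y - rep M t))) := by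
        rw [Finset.mul_sum]
    _ ≤ Real.exp (-(δ / 3 * (torusSupNorm M (y - y') + torusSupNorm M (y' - y'')))) * latticeConst (d + 1) (δ / 3) :=
        mul_le_mul_of_nonneg_left (sum_exp_torusSupNorm_sub_rep_le M (by positivity) y) (Real.exp_pos _).le
    _ = _ := mul_comm _ _

end Sums

/-! ## §3 The decay clause -/

section Decay

variable (n : ℕ) [NeZero n] (M : Fin (d + 1) → ℕ) [hM : ∀ μ, NeZero (M μ)]

/-- the cubic vertex sum at one fine point. [folklore] -/
theorem norm_vertex3_le (P : Tor (fine n M) → ι → Src M → ℂ) (Q : Tor (fine n M) → κ → Src M → ℂ) (W : Tor (fine n M) → ν → Src M → ℂ)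
    (m : Tor (fine n M) → ι → κ → ν → ℂ) {B CP CQ CW δ : ℝ} (hB : 0 ≤ B) (hCP : 0 ≤ CP) (hCQ : 0 ≤ CQ) (hm : ∀ x i j l, ‖m x i j l‖ ≤ B)
    (x : Tor (fine n M)) (y y' y'' : Fin (d + 1) → ℤ) (lam lam' lam'' : Fin (d + 1))
    (hP : ∀ i, ‖P x i (toT M y, lam)‖ ≤ CP * Real.exp (-(δ * torusSupNorm M (rep M (blockOf n M x) - y))))
    (hQ : ∀ j, ‖Q x j (toT M y', lam')‖ ≤ CQ * Real.exp (-(δ * torusSupNorm M (rep M (blockOf n M x) - y'))))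
    (hW : ∀ l, ‖W x l (toT M y'', lam'')‖ ≤ CW * Real.exp (-(δ * torusSupNorm M (rep M (blockOf n M x) - y'')))) :
    ‖∑ i : ι, ∑ j : κ, ∑ l : ν, m x i j l * P x i (toT M y, lam) * Q x j (toT M y', lam') * W x l (toT M y'', lam'')‖
      ≤ (Fintype.card ι : ℝ) * Fintype.card κ * Fintype.card ν * B * CP * CQ * CW *
          (Real.exp (-(δ * torusSupNorm M (rep M (blockOf n M x) - y))) * Real.exp (-(δ * torusSupNorm M (rep M (blockOf n M x) - y')))
            * Real.exp (-(δ * torusSupNorm M (rep M (blockOf n M x) - y'')))) := by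
  set E := Real.exp (-(δ * torusSupNorm M (rep M (blockOf n M x) - y)))
  set E' := Real.exp (-(δ * torusSupNorm M (rep M (blockOf n M x) - y')))
  set E'' := Real.exp (-(δ * torusSupNorm M (rep M (blockOf n M x) - y'')))
  have hterm : ∀ i j l, ‖m x i j l * P x i (toT M y, lam) * Q x j (toT M y', lam') * W x l (toT M y'', lam'')‖
      ≤ B * (CP * E) * (CQ * E') * (CW * E'') := fun i j l => by
    rw [norm_mul, norm_mul, norm_mul]
    exact mul_le_mul (mul_le_mul (mul_le_mul (hm x i j l) (hP i) (norm_nonneg _) hB) (hQ j) (norm_nonneg _)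
      (mul_nonneg hB (mul_nonneg hCP (Real.exp_pos _).le))) (hW l) (norm_nonneg _)
      (mul_nonneg (mul_nonneg hB (mul_nonneg hCP (Real.exp_pos _).le)) (mul_nonneg hCQ (Real.exp_pos _).le))
  calc _ ≤ ∑ i : ι, ‖∑ j : κ, ∑ l : ν, m x i j l * P x i (toT M y, lam) * Q x j (toT M y', lam') * W x l (toT M y'', lam'')‖ := norm_sum_le _ _
    _ ≤ ∑ i : ι, ∑ j : κ, ‖∑ l : ν, m x i j l * P x i (toT M y, lam) * Q x j (toT M y', lam') * W x l (toT M y'', lam'')‖ :=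
        Finset.sum_le_sum fun i _ => norm_sum_le _ _
    _ ≤ ∑ i : ι, ∑ j : κ, ∑ l : ν, ‖m x i j l * P x i (toT M y, lam) * Q x j (toT M y', lam') * W x l (toT M y'', lam'')‖ :=
        Finset.sum_le_sum fun i _ => Finset.sum_le_sum fun j _ => norm_sum_le _ _
    _ ≤ ∑ _i : ι, ∑ _j : κ, ∑ _l : ν, B * (CP * E) * (CQ * E') * (CW * E'') :=
        Finset.sum_le_sum fun i _ => Finset.sum_le_sum fun j _ => Finset.sum_le_sum fun l _ => hterm i j l
    _ = _ := by simp only [Finset.sum_const, Finset.card_univ, nsmul_eq_mul]; ring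

/-- **THE DECAY CLAUSE OF THE THREE-LEG CHAIN** (`δ > 0`):
`‖K(y,λ;y′,λ′;y″,λ″)‖ ≤ |ι||κ||ν|·B·CP·CQ·CW·latticeConst(d+1,δ∕3)·e^{−(δ∕3)(|y−y′|_T + |y′−y″|_T)}`. [folklore] -/
theorem norm_chain3_le (P : Tor (fine n M) → ι → Src M → ℂ) (Q : Tor (fine n M) → κ → Src M → ℂ) (W : Tor (fine n M) → ν → Src M → ℂ)
    (m : Tor (fine n M) → ι → κ → ν → ℂ) {B CP CQ CW δ : ℝ} (hδ : 0 < δ) (hB : 0 ≤ B) (hCP : 0 ≤ CP) (hCQ : 0 ≤ CQ) (hCW : 0 ≤ CW)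
    (hm : ∀ x i j l, ‖m x i j l‖ ≤ B)
    (hP : ∀ x i (y : Fin (d + 1) → ℤ) lam, ‖P x i (toT M y, lam)‖ ≤ CP * Real.exp (-(δ * torusSupNorm M (rep M (blockOf n M x) - y))))
    (hQ : ∀ x j (y : Fin (d + 1) → ℤ) lam, ‖Q x j (toT M y, lam)‖ ≤ CQ * Real.exp (-(δ * torusSupNorm M (rep M (blockOf n M x) - y))))
    (hW : ∀ x l (y : Fin (d + 1) → ℤ) lam, ‖W x l (toT M y, lam)‖ ≤ CW * Real.exp (-(δ * torusSupNorm M (rep M (blockOf n M x) - y))))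
    (y y' y'' : Fin (d + 1) → ℤ) (lam lam' lam'' : Fin (d + 1)) :
    ‖chain3 n M P Q W m (toT M y, lam) (toT M y', lam') (toT M y'', lam'')‖
      ≤ (Fintype.card ι : ℝ) * Fintype.card κ * Fintype.card ν * B * CP * CQ * CW * latticeConst (d + 1) (δ / 3)
          * Real.exp (-(δ / 3 * (torusSupNorm M (y - y') + torusSupNorm M (y' - y'')))) := by
  have hn : (0 : ℝ) < (n : ℝ) ^ (d + 1) := by have := Nat.pos_of_ne_zero (NeZero.ne n); positivity
  have hK : 0 ≤ (Fintype.card ι : ℝ) * Fintype.card κ * Fintype.card ν * B * CP * CQ * CW := by positivity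
  unfold chain3
  calc _ ≤ ∑ x : Tor (fine n M), ‖((((n : ℝ) ^ (d + 1))⁻¹ : ℝ) : ℂ) *
          ∑ i : ι, ∑ j : κ, ∑ l : ν, m x i j l * P x i (toT M y, lam) * Q x j (toT M y', lam') * W x l (toT M y'', lam'')‖ := norm_sum_le _ _
    _ ≤ ∑ x : Tor (fine n M), (((n : ℝ) ^ (d + 1))⁻¹) * ((Fintype.card ι : ℝ) * Fintype.card κ * Fintype.card ν * B * CP * CQ * CW *
          (Real.exp (-(δ * torusSupNorm M (rep M (blockOf n M x) - y))) * Real.exp (-(δ * torusSupNorm M (rep M (blockOf n M x) - y')))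
            * Real.exp (-(δ * torusSupNorm M (rep M (blockOf n M x) - y''))))) := by
        refine Finset.sum_le_sum fun x _ => ?_
        rw [norm_mul, Complex.norm_real, Real.norm_of_nonneg (inv_nonneg.mpr hn.le)]
        exact mul_le_mul_of_nonneg_left (norm_vertex3_le n M P Q W m hB hCP hCQ hm x y y' y'' lam lam' lam''
          (fun i => hP x i y lam) (fun j => hQ x j y' lam') (fun l => hW x l y'' lam'')) (inv_nonneg.mpr hn.le)
    _ = (Fintype.card ι : ℝ) * Fintype.card κ * Fintype.card ν * B * CP * CQ * CW * ∑ x : Tor (fine n M), (((n : ℝ) ^ (d + 1))⁻¹) *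
          (Real.exp (-(δ * torusSupNorm M (rep M (blockOf n M x) - y))) * Real.exp (-(δ * torusSupNorm M (rep M (blockOf n M x) - y')))
            * Real.exp (-(δ * torusSupNorm M (rep M (blockOf n M x) - y'')))) := by
        rw [Finset.mul_sum]; refine Finset.sum_congr rfl fun x _ => ?_; ring
    _ = (Fintype.card ι : ℝ) * Fintype.card κ * Fintype.card ν * B * CP * CQ * CW *
          ∑ t : Tor M, Real.exp (-(δ * torusSupNorm M (rep M t - y))) * Real.exp (-(δ * torusSupNorm M (rep M t - y')))
            * Real.exp (-(δ * torusSupNorm M (rep M t - y''))) := by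
        rw [sum_blockConst M (fun z => Real.exp (-(δ * torusSupNorm M (z - y))) * Real.exp (-(δ * torusSupNorm M (z - y')))
          * Real.exp (-(δ * torusSupNorm M (z - y''))))]
    _ ≤ (Fintype.card ι : ℝ) * Fintype.card κ * Fintype.card ν * B * CP * CQ * CW *
          (latticeConst (d + 1) (δ / 3) * Real.exp (-(δ / 3 * (torusSupNorm M (y - y') + torusSupNorm M (y' - y''))))) :=
        mul_le_mul_of_nonneg_left (sum_exp_three_centre_le M hδ y y' y'') hK
    _ = _ := by ring

end Decay

/-! ## §4 The one-step clause (general `N, R`) -/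

section Step

variable {N R : ℕ} [NeZero N] [NeZero R] (M : Fin (d + 1) → ℕ) [hM : ∀ μ, NeZero (M μ)]

/-- the Leibniz bound at one fine point for three legs and a cubic vertex. [folklore] -/
theorem norm_vertex3_sub_le (P' : Tor (fine (R * N) M) → ι → Src M → ℂ) (P : Tor (fine N M) → ι → Src M → ℂ)
    (Q' : Tor (fine (R * N) M) → κ → Src M → ℂ) (Q : Tor (fine N M) → κ → Src M → ℂ)
    (W' : Tor (fine (R * N) M) → ν → Src M → ℂ) (W : Tor (fine N M) → ν → Src M → ℂ)
    (m' : Tor (fine (R * N) M) → ι → κ → ν → ℂ) (m : Tor (fine N M) → ι → κ → ν → ℂ)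
    {B CP CQ CW ρP ρQ ρW εm δ : ℝ} (hB : 0 ≤ B) (hCP : 0 ≤ CP) (hCQ : 0 ≤ CQ) (hρP : 0 ≤ ρP) (hρQ : 0 ≤ ρQ) (hε : 0 ≤ εm)
    (x' : Tor (fine (R * N) M)) (y y' y'' : Fin (d + 1) → ℤ) (lam lam' lam'' : Fin (d + 1))
    (hm' : ∀ i j l, ‖m' x' i j l‖ ≤ B) (hm : ∀ i j l, ‖m (par N R M x') i j l‖ ≤ B) (htr : ∀ i j l, ‖m' x' i j l - m (par N R M x') i j l‖ ≤ εm)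
    (hP : ∀ i, ‖P (par N R M x') i (toT M y, lam)‖ ≤ CP * Real.exp (-(δ * torusSupNorm M (rep M (blockOf (R * N) M x') - y))))
    (hQ' : ∀ j, ‖Q' x' j (toT M y', lam')‖ ≤ CQ * Real.exp (-(δ * torusSupNorm M (rep M (blockOf (R * N) M x') - y'))))
    (hQ : ∀ j, ‖Q (par N R M x') j (toT M y', lam')‖ ≤ CQ * Real.exp (-(δ * torusSupNorm M (rep M (blockOf (R * N) M x') - y'))))
    (hW' : ∀ l, ‖W' x' l (toT M y'', lam'')‖ ≤ CW * Real.exp (-(δ * torusSupNorm M (rep M (blockOf (R * N) M x') - y''))))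
    (hdP : ∀ i, ‖P' x' i (toT M y, lam) - P (par N R M x') i (toT M y, lam)‖
      ≤ ρP * Real.exp (-(δ * torusSupNorm M (rep M (blockOf (R * N) M x') - y))))
    (hdQ : ∀ j, ‖Q' x' j (toT M y', lam') - Q (par N R M x') j (toT M y', lam')‖
      ≤ ρQ * Real.exp (-(δ * torusSupNorm M (rep M (blockOf (R * N) M x') - y'))))
    (hdW : ∀ l, ‖W' x' l (toT M y'', lam'') - W (par N R M x') l (toT M y'', lam'')‖
      ≤ ρW * Real.exp (-(δ * torusSupNorm M (rep M (blockOf (R * N) M x') - y'')))) :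
    ‖∑ i : ι, ∑ j : κ, ∑ l : ν, (m' x' i j l * P' x' i (toT M y, lam) * Q' x' j (toT M y', lam') * W' x' l (toT M y'', lam'')
        - m (par N R M x') i j l * P (par N R M x') i (toT M y, lam) * Q (par N R M x') j (toT M y', lam')
            * W (par N R M x') l (toT M y'', lam''))‖
      ≤ (Fintype.card ι : ℝ) * Fintype.card κ * Fintype.card ν * (ρP * B * CQ * CW + CP * εm * CQ * CW + CP * B * ρQ * CW + CP * B * CQ * ρW)
          * (Real.exp (-(δ * torusSupNorm M (rep M (blockOf (R * N) M x') - y)))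
              * Real.exp (-(δ * torusSupNorm M (rep M (blockOf (R * N) M x') - y')))
              * Real.exp (-(δ * torusSupNorm M (rep M (blockOf (R * N) M x') - y'')))) := by
  set E := Real.exp (-(δ * torusSupNorm M (rep M (blockOf (R * N) M x') - y)))
  set E' := Real.exp (-(δ * torusSupNorm M (rep M (blockOf (R * N) M x') - y')))
  set E'' := Real.exp (-(δ * torusSupNorm M (rep M (blockOf (R * N) M x') - y'')))
  have hE : 0 ≤ E := (Real.exp_pos _).le
  have hE' : 0 ≤ E' := (Real.exp_pos _).le
  have hE'' : 0 ≤ E'' := (Real.exp_pos _).le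
  have hterm : ∀ i j l, ‖m' x' i j l * P' x' i (toT M y, lam) * Q' x' j (toT M y', lam') * W' x' l (toT M y'', lam'')
        - m (par N R M x') i j l * P (par N R M x') i (toT M y, lam) * Q (par N R M x') j (toT M y', lam') * W (par N R M x') l (toT M y'', lam'')‖
      ≤ (ρP * B * CQ * CW + CP * εm * CQ * CW + CP * B * ρQ * CW + CP * B * CQ * ρW) * (E * E' * E'') := by
    intro i j l
    set a' := m' x' i j l; set a := m (par N R M x') i j l
    set b' := P' x' i (toT M y, lam); set b := P (par N R M x') i (toT M y, lam)
    set c' := Q' x' j (toT M y', lam'); set c := Q (par N R M x') j (toT M y', lam')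
    set e' := W' x' l (toT M y'', lam''); set e := W (par N R M x') l (toT M y'', lam'')
    have eq : a' * b' * c' * e' - a * b * c * e
        = (b' - b) * a' * c' * e' + b * (a' - a) * c' * e' + b * a * (c' - c) * e' + b * a * c * (e' - e) := by ring
    rw [eq]
    have h1 : ‖(b' - b) * a' * c' * e'‖ ≤ (ρP * E) * B * (CQ * E') * (CW * E'') := by
      rw [norm_mul, norm_mul, norm_mul]
      exact mul_le_mul (mul_le_mul (mul_le_mul (hdP i) (hm' i j l) (norm_nonneg _) (mul_nonneg hρP hE)) (hQ' j) (norm_nonneg _)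
        (mul_nonneg (mul_nonneg hρP hE) hB)) (hW' l) (norm_nonneg _)
        (mul_nonneg (mul_nonneg (mul_nonneg hρP hE) hB) (mul_nonneg hCQ hE'))
    have h2 : ‖b * (a' - a) * c' * e'‖ ≤ (CP * E) * εm * (CQ * E') * (CW * E'') := by
      rw [norm_mul, norm_mul, norm_mul]
      exact mul_le_mul (mul_le_mul (mul_le_mul (hP i) (htr i j l) (norm_nonneg _) (mul_nonneg hCP hE)) (hQ' j) (norm_nonneg _)
        (mul_nonneg (mul_nonneg hCP hE) hε)) (hW' l) (norm_nonneg _)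
        (mul_nonneg (mul_nonneg (mul_nonneg hCP hE) hε) (mul_nonneg hCQ hE'))
    have h3 : ‖b * a * (c' - c) * e'‖ ≤ (CP * E) * B * (ρQ * E') * (CW * E'') := by
      rw [norm_mul, norm_mul, norm_mul]
      exact mul_le_mul (mul_le_mul (mul_le_mul (hP i) (hm i j l) (norm_nonneg _) (mul_nonneg hCP hE)) (hdQ j) (norm_nonneg _)
        (mul_nonneg (mul_nonneg hCP hE) hB)) (hW' l) (norm_nonneg _)
        (mul_nonneg (mul_nonneg (mul_nonneg hCP hE) hB) (mul_nonneg hρQ hE'))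
    have h4 : ‖b * a * c * (e' - e)‖ ≤ (CP * E) * B * (CQ * E') * (ρW * E'') := by
      rw [norm_mul, norm_mul, norm_mul]
      exact mul_le_mul (mul_le_mul (mul_le_mul (hP i) (hm i j l) (norm_nonneg _) (mul_nonneg hCP hE)) (hQ j) (norm_nonneg _)
        (mul_nonneg (mul_nonneg hCP hE) hB)) (hdW l) (norm_nonneg _)
        (mul_nonneg (mul_nonneg (mul_nonneg hCP hE) hB) (mul_nonneg hCQ hE'))
    calc _ ≤ ‖(b' - b) * a' * c' * e'‖ + ‖b * (a' - a) * c' * e'‖ + ‖b * a * (c' - c) * e'‖ + ‖b * a * c * (e' - e)‖ := by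
          refine (norm_add_le _ _).trans (add_le_add ((norm_add_le _ _).trans (add_le_add (norm_add_le _ _) le_rfl)) le_rfl)
      _ ≤ (ρP * E) * B * (CQ * E') * (CW * E'') + (CP * E) * εm * (CQ * E') * (CW * E'') + (CP * E) * B * (ρQ * E') * (CW * E'')
          + (CP * E) * B * (CQ * E') * (ρW * E'') := add_le_add (add_le_add (add_le_add h1 h2) h3) h4
      _ = _ := by ring
  calc _ ≤ ∑ i : ι, ‖∑ j : κ, ∑ l : ν, (m' x' i j l * P' x' i (toT M y, lam) * Q' x' j (toT M y', lam') * W' x' l (toT M y'', lam'')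
          - m (par N R M x') i j l * P (par N R M x') i (toT M y, lam) * Q (par N R M x') j (toT M y', lam')
              * W (par N R M x') l (toT M y'', lam''))‖ := norm_sum_le _ _
    _ ≤ ∑ i : ι, ∑ j : κ, ‖∑ l : ν, (m' x' i j l * P' x' i (toT M y, lam) * Q' x' j (toT M y', lam') * W' x' l (toT M y'', lam'')
          - m (par N R M x') i j l * P (par N R M x') i (toT M y, lam) * Q (par N R M x') j (toT M y', lam')
              * W (par N R M x') l (toT M y'', lam''))‖ := Finset.sum_le_sum fun i _ => norm_sum_le _ _
    _ ≤ ∑ i : ι, ∑ j : κ, ∑ l : ν, ‖m' x' i j l * P' x' i (toT M y, lam) * Q' x' j (toT M y', lam') * W' x' l (toT M y'', lam'')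
          - m (par N R M x') i j l * P (par N R M x') i (toT M y, lam) * Q (par N R M x') j (toT M y', lam')
              * W (par N R M x') l (toT M y'', lam'')‖ :=
        Finset.sum_le_sum fun i _ => Finset.sum_le_sum fun j _ => norm_sum_le _ _
    _ ≤ ∑ _i : ι, ∑ _j : κ, ∑ _l : ν, (ρP * B * CQ * CW + CP * εm * CQ * CW + CP * B * ρQ * CW + CP * B * CQ * ρW) * (E * E' * E'') :=
        Finset.sum_le_sum fun i _ => Finset.sum_le_sum fun j _ => Finset.sum_le_sum fun l _ => hterm i j l
    _ = _ := by simp only [Finset.sum_const, Finset.card_univ, nsmul_eq_mul]; ring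

/-- **THE ONE-STEP CLAUSE OF THE THREE-LEG CHAIN** (every torus, general `N, R ≥ 1`, `δ > 0`): block-decaying legs (`CP, CQ, CW`, the coarse
legs read at `par x′`) with parent laws (`ρP, ρQ, ρW`), cubic vertex bounded by `B` at both levels with transport `εm` ⇒
`‖K′ − K‖ ≤ |ι||κ||ν|·(ρP·B·CQ·CW + CP·εm·CQ·CW + CP·B·ρQ·CW + CP·B·CQ·ρW)·latticeConst(d+1,δ∕3)·e^{−(δ∕3)(|y−y′|_T+|y′−y″|_T)}`.
[cite: King1986, §4 p.672 (Leibniz mechanism)] [folklore] -/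
theorem norm_chain3_succ_sub_le (P' : Tor (fine (R * N) M) → ι → Src M → ℂ) (P : Tor (fine N M) → ι → Src M → ℂ)
    (Q' : Tor (fine (R * N) M) → κ → Src M → ℂ) (Q : Tor (fine N M) → κ → Src M → ℂ)
    (W' : Tor (fine (R * N) M) → ν → Src M → ℂ) (W : Tor (fine N M) → ν → Src M → ℂ)
    (m' : Tor (fine (R * N) M) → ι → κ → ν → ℂ) (m : Tor (fine N M) → ι → κ → ν → ℂ)
    {B CP CQ CW ρP ρQ ρW εm δ : ℝ} (hδ : 0 < δ) (hB : 0 ≤ B) (hCP : 0 ≤ CP) (hCQ : 0 ≤ CQ) (hCW : 0 ≤ CW) (hρP : 0 ≤ ρP) (hρQ : 0 ≤ ρQ)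
    (hρW : 0 ≤ ρW) (hε : 0 ≤ εm)
    (hm' : ∀ x i j l, ‖m' x i j l‖ ≤ B) (hm : ∀ x i j l, ‖m x i j l‖ ≤ B) (htr : ∀ x' i j l, ‖m' x' i j l - m (par N R M x') i j l‖ ≤ εm)
    (hP : ∀ (x' : Tor (fine (R * N) M)) i (y : Fin (d + 1) → ℤ) lam,
      ‖P (par N R M x') i (toT M y, lam)‖ ≤ CP * Real.exp (-(δ * torusSupNorm M (rep M (blockOf (R * N) M x') - y))))
    (hQ' : ∀ (x' : Tor (fine (R * N) M)) j (y : Fin (d + 1) → ℤ) lam,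
      ‖Q' x' j (toT M y, lam)‖ ≤ CQ * Real.exp (-(δ * torusSupNorm M (rep M (blockOf (R * N) M x') - y))))
    (hQ : ∀ (x' : Tor (fine (R * N) M)) j (y : Fin (d + 1) → ℤ) lam,
      ‖Q (par N R M x') j (toT M y, lam)‖ ≤ CQ * Real.exp (-(δ * torusSupNorm M (rep M (blockOf (R * N) M x') - y))))
    (hW' : ∀ (x' : Tor (fine (R * N) M)) l (y : Fin (d + 1) → ℤ) lam,
      ‖W' x' l (toT M y, lam)‖ ≤ CW * Real.exp (-(δ * torusSupNorm M (rep M (blockOf (R * N) M x') - y))))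
    (hdP : ∀ (x' : Tor (fine (R * N) M)) i (y : Fin (d + 1) → ℤ) lam,
      ‖P' x' i (toT M y, lam) - P (par N R M x') i (toT M y, lam)‖ ≤ ρP * Real.exp (-(δ * torusSupNorm M (rep M (blockOf (R * N) M x') - y))))
    (hdQ : ∀ (x' : Tor (fine (R * N) M)) j (y : Fin (d + 1) → ℤ) lam,
      ‖Q' x' j (toT M y, lam) - Q (par N R M x') j (toT M y, lam)‖ ≤ ρQ * Real.exp (-(δ * torusSupNorm M (rep M (blockOf (R * N) M x') - y))))
    (hdW : ∀ (x' : Tor (fine (R * N) M)) l (y : Fin (d + 1) → ℤ) lam,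
      ‖W' x' l (toT M y, lam) - W (par N R M x') l (toT M y, lam)‖ ≤ ρW * Real.exp (-(δ * torusSupNorm M (rep M (blockOf (R * N) M x') - y))))
    (y y' y'' : Fin (d + 1) → ℤ) (lam lam' lam'' : Fin (d + 1)) :
    ‖chain3 (R * N) M P' Q' W' m' (toT M y, lam) (toT M y', lam') (toT M y'', lam'')
        - chain3 N M P Q W m (toT M y, lam) (toT M y', lam') (toT M y'', lam'')‖
      ≤ (Fintype.card ι : ℝ) * Fintype.card κ * Fintype.card ν * (ρP * B * CQ * CW + CP * εm * CQ * CW + CP * B * ρQ * CW + CP * B * CQ * ρW)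
          * latticeConst (d + 1) (δ / 3) * Real.exp (-(δ / 3 * (torusSupNorm M (y - y') + torusSupNorm M (y' - y'')))) := by
  have hn' : (0 : ℝ) < (((R * N : ℕ) : ℝ)) ^ (d + 1) := by have := Nat.pos_of_ne_zero (NeZero.ne (R * N)); positivity
  have hK : 0 ≤ (Fintype.card ι : ℝ) * Fintype.card κ * Fintype.card ν
      * (ρP * B * CQ * CW + CP * εm * CQ * CW + CP * B * ρQ * CW + CP * B * CQ * ρW) := by positivity
  set G : Tor (fine N M) → ℂ := fun x => ∑ i : ι, ∑ j : κ, ∑ l : ν,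
      m x i j l * P x i (toT M y, lam) * Q x j (toT M y', lam') * W x l (toT M y'', lam'') with hG
  have hcoarse : chain3 N M P Q W m (toT M y, lam) (toT M y', lam') (toT M y'', lam'')
      = ∑ x' : Tor (fine (R * N) M), ((((((R * N : ℕ) : ℝ)) ^ (d + 1))⁻¹ : ℝ) : ℂ) * G (par N R M x') := by
    unfold chain3; rw [sum_child_par_complex M G]
  rw [hcoarse]
  unfold chain3
  rw [← Finset.sum_sub_distrib]
  calc _ ≤ ∑ x' : Tor (fine (R * N) M), ‖((((((R * N : ℕ) : ℝ)) ^ (d + 1))⁻¹ : ℝ) : ℂ) *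
            ∑ i : ι, ∑ j : κ, ∑ l : ν, m' x' i j l * P' x' i (toT M y, lam) * Q' x' j (toT M y', lam') * W' x' l (toT M y'', lam'')
          - ((((((R * N : ℕ) : ℝ)) ^ (d + 1))⁻¹ : ℝ) : ℂ) * G (par N R M x')‖ := norm_sum_le _ _
    _ ≤ ∑ x' : Tor (fine (R * N) M), ((((R * N : ℕ) : ℝ)) ^ (d + 1))⁻¹ *
          ((Fintype.card ι : ℝ) * Fintype.card κ * Fintype.card ν * (ρP * B * CQ * CW + CP * εm * CQ * CW + CP * B * ρQ * CW + CP * B * CQ * ρW) *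
            (Real.exp (-(δ * torusSupNorm M (rep M (blockOf (R * N) M x') - y)))
              * Real.exp (-(δ * torusSupNorm M (rep M (blockOf (R * N) M x') - y')))
              * Real.exp (-(δ * torusSupNorm M (rep M (blockOf (R * N) M x') - y''))))) := by
        refine Finset.sum_le_sum fun x' _ => ?_
        rw [← mul_sub, norm_mul, Complex.norm_real, Real.norm_of_nonneg (inv_nonneg.mpr hn'.le)]
        refine mul_le_mul_of_nonneg_left ?_ (inv_nonneg.mpr hn'.le)
        rw [hG]
        dsimp only
        rw [← Finset.sum_sub_distrib]
        simp_rw [← Finset.sum_sub_distrib]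
        exact norm_vertex3_sub_le M P' P Q' Q W' W m' m hB hCP hCQ hρP hρQ hε x' y y' y'' lam lam' lam'' (hm' x') (hm _) (htr x')
          (fun i => hP x' i y lam) (fun j => hQ' x' j y' lam') (fun j => hQ x' j y' lam') (fun l => hW' x' l y'' lam'')
          (fun i => hdP x' i y lam) (fun j => hdQ x' j y' lam') (fun l => hdW x' l y'' lam'')
    _ = (Fintype.card ι : ℝ) * Fintype.card κ * Fintype.card ν * (ρP * B * CQ * CW + CP * εm * CQ * CW + CP * B * ρQ * CW + CP * B * CQ * ρW) *
          ∑ x' : Tor (fine (R * N) M), ((((R * N : ℕ) : ℝ)) ^ (d + 1))⁻¹ *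
            (Real.exp (-(δ * torusSupNorm M (rep M (blockOf (R * N) M x') - y)))
              * Real.exp (-(δ * torusSupNorm M (rep M (blockOf (R * N) M x') - y')))
              * Real.exp (-(δ * torusSupNorm M (rep M (blockOf (R * N) M x') - y'')))) := by
        rw [Finset.mul_sum]; refine Finset.sum_congr rfl fun x _ => ?_; ring
    _ = (Fintype.card ι : ℝ) * Fintype.card κ * Fintype.card ν * (ρP * B * CQ * CW + CP * εm * CQ * CW + CP * B * ρQ * CW + CP * B * CQ * ρW) *
          ∑ t : Tor M, Real.exp (-(δ * torusSupNorm M (rep M t - y))) * Real.exp (-(δ * torusSupNorm M (rep M t - y')))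
            * Real.exp (-(δ * torusSupNorm M (rep M t - y''))) := by
        rw [sum_blockConst M (fun z => Real.exp (-(δ * torusSupNorm M (z - y))) * Real.exp (-(δ * torusSupNorm M (z - y')))
          * Real.exp (-(δ * torusSupNorm M (z - y''))))]
    _ ≤ (Fintype.card ι : ℝ) * Fintype.card κ * Fintype.card ν * (ρP * B * CQ * CW + CP * εm * CQ * CW + CP * B * ρQ * CW + CP * B * CQ * ρW) *
          (latticeConst (d + 1) (δ / 3) * Real.exp (-(δ / 3 * (torusSupNorm M (y - y') + torusSupNorm M (y' - y''))))) :=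
        mul_le_mul_of_nonneg_left (sum_exp_three_centre_le M hδ y y' y'') hK
    _ = _ := by ring

end Step

end Summit.QuantumFields.BalabanUV.Beta.GAN24.ThreeLegChainKing

end
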